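import Mathlib.Analysis.SpecialFunctions.Trigonometric.Bounds
import Mathlib.Analysis.SpecialFunctions.Trigonometric.Series
import Mathlib.Analysis.SpecialFunctions.Trigonometric.DerivHyp
import Mathlib.Analysis.SpecialFunctions.Complex.Log
import Mathlib.Analysis.Real.Pi.Bounds
import Mathlib.Analysis.Complex.ExponentialBounds
import Literature.Probability.LatticeModels.LatticeLaplacian
import HarnessLib

/-!
# Discrete sine series: the harmonic function of a box with data on one side, and its size under a window

Topic `Literature/Probability/LatticeModels`; the harmonic-measure input of the first-moment
bound (Proposition 13) in the Russo–Seymour–Welsh programme for the critical FK-Ising model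
after Duminil-Copin–Hongler–Nolin (arXiv:0912.4253), whose Lemma 9 ("the harmonic measure of
the wired point seen from `x` is of order `1/n²` … follows from standard results on simple random
walks; we do not provide a detailed proof") is replaced here by an explicit construction: the
solution of the discrete Dirichlet problem on a box with data on its top side by a finite sine
series, and a quantitative lower bound for window data. Everything is proved; [folklore] discrete
Fourier analysis, elementary estimates.

* `sum_range_cos_mul_eq`, `sum_range_sin_mul_sin`: half-period cosine sums by a complex
  geometric sum, and the **discrete sine orthogonality** on `{1, …, L}` (DST-I).
* The modes: `dstAngle L m = θ_m = mπ/(L+1)`, `dstC = c_m = 2 - cos θ_m`,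
  `dstR = r_m = c_m + √(c_m² - 1)` (`r + 1/r = 2c`, `dstR_add_inv`), the vertical profile
  `dstProfile L m Y = r_m^Y - r_m^{-Y}` with `φ(Y+1) + φ(Y-1) = 2 c_m φ(Y)` and the horizontal
  mode `dstSin L m X = sin (m X π/(L+1))` with `e(X+1) + e(X-1) = 2 cos θ_m e(X)`.
* `boxSine L M d`: `ψ(X, Y) = ∑_m a_m e_m(X) φ_m(Y)/φ_m(M+1)` with the sine coefficients
  `sineCoeff` of the data `d`; **`latticeLaplacian_boxSine`** (harmonic on all of `ℤ²`),
  `boxSine_left/right/bottom` (zero on three sides), **`boxSine_top`** (reproduces `d` on the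
  top side `Y = M+1`, `1 ≤ X ≤ L`).
* Analytic control of the modes: `dstR_le_exp` (`r_m ≤ e^{θ_m}`, from `cos θ + cosh θ ≥ 2`),
  `exp_le_modeR` (`e^{0.95 θ_m} ≤ r_m` for `θ_m ≤ 3/10`), `dstR_mono`, `dstProfile_one_le`,
  `le_modeProfile_one_first`.
* **`boxSine_window_lower_bound`**: for `L ≥ 40`, `7(L+1) ≤ 2(M+1) ≤ 8(L+1)`, data
  `γ · 1_{[X₀, X₀+2]}` (`windowData`, `γ ≥ 0`) with the window and the observation column `X₁`
  in the middle half, `ψ(X₁, 1) ≥ 3 e^{-4π} γ/(L+1)²` — the first mode contributes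
  `≥ 6 e^{-4π} γ/(L+1)²` (`first_term_lower_bound`) and the other modes at most half of that,
  being damped by `r_m^{-(M+1)} ≤ e^{-0.95 θ_m (M+1)}` (small angles) or `e^{-b}`, `b ≈ 0.95 L`
  (large angles).

With the comparison principle of `LatticeLaplacian.lean`, `ψ` is a lower barrier for any
nonnegative superharmonic function on the box which is `≥ γ` on the window: this is how the
discrete primitive of the FK observable will be bounded below in the bar domain
(`LatticeDobrushinBox.barDomain`).

## References

* H. Duminil-Copin, C. Hongler, P. Nolin, *Connection probabilities and RSW-type bounds for the
  two-dimensional FK Ising model*, Comm. Pure Appl. Math. 64 (2011) 1165–1198, §3.2 (Lemma 9)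
  and §4 (Proposition 13) — bib key `DuminilCopinHonglerNolin2011`.
* G. Lawler, V. Limic, *Random Walk: A Modern Introduction* (2010), §8.1 (eigenfunction
  expansions for the Dirichlet problem in a box).
-/

noncomputable section

namespace Literature.Probability.LatticeModels

open Finset Real

/-! ### Cosine sums over a half period -/

/-- **Half-period cosine sums.** For `α = jπ/(L+1)` with `e^{iα} ≠ 1`,
`∑_{m=0}^{L} cos(m α) = (1 - (-1)^j)/2`. [folklore] -/
theorem sum_range_cos_mul_eq (L : ℕ) (j : ℤ) (hj : Complex.exp ((j * (π / (L + 1)) : ℝ) * Complex.I) ≠ 1) :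
    ∑ m ∈ range (L + 1), Real.cos (m * (j * (π / (L + 1)))) = (1 - (-1 : ℝ) ^ j) / 2 := by
  set α : ℝ := j * (π / (L + 1)) with hα
  set w : ℂ := Complex.exp (α * Complex.I) with hw
  have hw1 : w ≠ 1 := hj
  -- the geometric sum
  have hgeom : ∑ m ∈ range (L + 1), w ^ m = (w ^ (L + 1) - 1) / (w - 1) := geom_sum_eq hw1 (L + 1)
  -- `w^{L+1} = e^{ijπ} = (-1)^j`
  have hpow : w ^ (L + 1) = (-1 : ℂ) ^ j := by
    rw [hw, ← Complex.exp_nat_mul, ← Complex.exp_pi_mul_I, ← Complex.exp_int_mul]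
    congr 1
    simp only [hα]
    push_cast
    field_simp
  -- real parts
  have hre : ∀ m : ℕ, (w ^ m).re = Real.cos (m * α) := by
    intro m
    rw [hw, ← Complex.exp_nat_mul, show (m : ℂ) * (α * Complex.I) = ((m * α : ℝ) : ℂ) * Complex.I by push_cast; ring,
      Complex.exp_ofReal_mul_I_re]
  have hsum : (∑ m ∈ range (L + 1), Real.cos (m * α)) = (∑ m ∈ range (L + 1), w ^ m).re := by
    rw [Complex.re_sum]
    exact Finset.sum_congr rfl fun m _ => (hre m).symm
  rw [hsum, hgeom, hpow]
  -- `Re (1/(w-1)) = -1/2`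
  have hcos1 : Real.cos α ≠ 1 := by
    intro h
    apply hw1
    rw [hw, Complex.exp_eq_one_iff]
    rw [Real.cos_eq_one_iff] at h
    obtain ⟨n, hn⟩ := h
    refine ⟨n, ?_⟩
    rw [← hn]; push_cast; ring
  have hwre : w.re = Real.cos α := by rw [hw, Complex.exp_ofReal_mul_I_re]
  have hwim : w.im = Real.sin α := by rw [hw, Complex.exp_ofReal_mul_I_im]
  have hnorm : Complex.normSq (w - 1) = 2 - 2 * Real.cos α := by
    rw [Complex.normSq_apply]
    simp only [Complex.sub_re, Complex.one_re, Complex.sub_im, Complex.one_im, sub_zero, hwre, hwim]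
    nlinarith [Real.sin_sq_add_cos_sq α]
  have hinv : ((w - 1)⁻¹).re = -1 / 2 := by
    rw [Complex.inv_re, hnorm]
    simp only [Complex.sub_re, Complex.one_re, hwre]
    have : (2 : ℝ) - 2 * Real.cos α ≠ 0 := by
      intro h; apply hcos1; linarith
    field_simp
    ring
  rcases Int.even_or_odd j with hje | hjo
  · rw [hje.neg_one_zpow, hje.neg_one_zpow]
    simp
  · rw [hjo.neg_one_zpow, hjo.neg_one_zpow, div_eq_mul_inv, Complex.mul_re (-1 - 1), hinv]
    simp only [Complex.sub_re, Complex.neg_re, Complex.one_re, Complex.sub_im, Complex.neg_im, Complex.one_im,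
      neg_zero, sub_zero, zero_mul]
    norm_num

/-- `e^{ijπ/(L+1)} ≠ 1` for `0 < |j| < 2(L+1)`. [folklore] -/
theorem exp_ne_one_of_lt (L : ℕ) (j : ℤ) (hj0 : j ≠ 0) (hj : |j| < 2 * (L + 1)) :
    Complex.exp ((j * (π / (L + 1)) : ℝ) * Complex.I) ≠ 1 := by
  intro h
  rw [Complex.exp_eq_one_iff] at h
  obtain ⟨n, hn⟩ := h
  have hπ : (π : ℂ) ≠ 0 := by exact_mod_cast Real.pi_ne_zero
  have hL : ((L : ℂ) + 1) ≠ 0 := by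
    have : ((L + 1 : ℕ) : ℂ) ≠ 0 := Nat.cast_ne_zero.2 (Nat.succ_ne_zero L)
    push_cast at this
    exact this
  have h' := hn
  push_cast at h'
  field_simp at h'
  have key' : j = n * (2 * (L + 1)) := by
    have : (j : ℂ) = n * (2 * (L + 1)) := by linear_combination h'
    exact_mod_cast this
  rcases eq_or_ne n 0 with rfl | hn0
  · simp at key'; exact hj0 key'
  · have : (2 * (L + 1) : ℤ) ≤ |j| := by
      rw [key', abs_mul]
      have h1 : (1 : ℤ) ≤ |n| := Int.one_le_abs hn0
      have h2 : |(2 * ((L : ℤ) + 1))| = 2 * (L + 1) := abs_of_nonneg (by positivity)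
      rw [h2]
      nlinarith
    omega

/-- **Discrete sine orthogonality (DST-I).** For `1 ≤ X, X' ≤ L` and `θ = π/(L+1)`,
`∑_{m=0}^{L} sin(m X θ) sin(m X' θ) = (L+1)/2` if `X = X'` and `0` otherwise. [folklore] -/
theorem sum_range_sin_mul_sin (L : ℕ) {X X' : ℤ} (hX : 1 ≤ X ∧ X ≤ L) (hX' : 1 ≤ X' ∧ X' ≤ L) :
    ∑ m ∈ range (L + 1), Real.sin (m * (X * (π / (L + 1)))) * Real.sin (m * (X' * (π / (L + 1)))) =
      if X = X' then ((L : ℝ) + 1) / 2 else 0 := by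
  have hprod : ∀ m : ℕ, Real.sin (m * (X * (π / (L + 1)))) * Real.sin (m * (X' * (π / (L + 1)))) =
      (Real.cos (m * ((X - X' : ℤ) * (π / (L + 1)))) - Real.cos (m * ((X + X' : ℤ) * (π / (L + 1))))) / 2 := by
    intro m
    rw [Real.cos_sub_cos]
    push_cast
    have e1 : (m * ((X - X') * (π / (L + 1))) + m * ((X + X') * (π / (L + 1)))) / 2 = m * (X * (π / (L + 1))) := by ring
    have e2 : (m * ((X - X') * (π / (L + 1))) - m * ((X + X') * (π / (L + 1)))) / 2 = -(m * (X' * (π / (L + 1)))) := by ring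
    rw [e1, e2, Real.sin_neg]; ring
  simp_rw [hprod]
  rw [← Finset.sum_div, Finset.sum_sub_distrib]
  have hsum2 : ∑ m ∈ range (L + 1), Real.cos (m * ((X + X' : ℤ) * (π / (L + 1)))) = (1 - (-1 : ℝ) ^ (X + X')) / 2 :=
    sum_range_cos_mul_eq L (X + X') (exp_ne_one_of_lt L _ (by omega) (by rw [abs_of_nonneg (by omega)]; omega))
  split_ifs with hXX
  · subst hXX
    have hsum1 : ∑ m ∈ range (L + 1), Real.cos (m * ((X - X : ℤ) * (π / (L + 1)))) = L + 1 := by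
      simp
    rw [hsum1, hsum2]
    have he : Even (X + X) := ⟨X, rfl⟩
    rw [he.neg_one_zpow]
    ring
  · have hsum1 : ∑ m ∈ range (L + 1), Real.cos (m * ((X - X' : ℤ) * (π / (L + 1)))) = (1 - (-1 : ℝ) ^ (X - X')) / 2 :=
      sum_range_cos_mul_eq L (X - X') (exp_ne_one_of_lt L _ (sub_ne_zero.2 hXX) (by
        rw [abs_lt]; constructor <;> omega))
    rw [hsum1, hsum2]
    -- same parity
    have hpar : (-1 : ℝ) ^ (X - X') = (-1 : ℝ) ^ (X + X') := by
      rcases Int.even_or_odd (X - X') with h | h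
      · have h' : Even (X + X') := by obtain ⟨k, hk⟩ := h; exact ⟨k + X', by omega⟩
        rw [h.neg_one_zpow, h'.neg_one_zpow]
      · have h' : Odd (X + X') := by obtain ⟨k, hk⟩ := h; exact ⟨k + X', by omega⟩
        rw [h.neg_one_zpow, h'.neg_one_zpow]
    rw [hpar]; ring

/-! ### The modes of the box -/

/-- The angle of the `m`-th mode of a box of width `L`: `θ_m = mπ/(L+1)`. [folklore] -/
def dstAngle (L m : ℕ) : ℝ := m * (π / (L + 1))

/-- `c_m = 2 - cos θ_m ∈ [1, 3]`: the vertical recurrence `φ(Y+1) + φ(Y-1) = 2 c_m φ(Y)` balancing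
the horizontal one `e(X+1) + e(X-1) = 2 cos θ_m e(X)`. [folklore] -/
def dstC (L m : ℕ) : ℝ := 2 - Real.cos (dstAngle L m)

/-- The growth rate of the `m`-th mode: `r_m = c_m + √(c_m² - 1) ≥ 1`, the root `≥ 1` of
`r + 1/r = 2 c_m` (so that `r_m = e^{μ_m}`, `cosh μ_m = c_m`). [folklore] -/
def dstR (L m : ℕ) : ℝ := dstC L m + Real.sqrt (dstC L m ^ 2 - 1)

variable {L m : ℕ}

/-- `1 ≤ c_m`. [folklore] -/
theorem one_le_modeC : 1 ≤ dstC L m := by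
  have := Real.cos_le_one (dstAngle L m); unfold dstC; linarith

/-- `c_m ≤ 3`. [folklore] -/
theorem dstC_le_three : dstC L m ≤ 3 := by
  have := Real.neg_one_le_cos (dstAngle L m); unfold dstC; linarith

/-- `1 ≤ r_m`. [folklore] -/
theorem one_le_modeR : 1 ≤ dstR L m := by
  have := Real.sqrt_nonneg (dstC L m ^ 2 - 1); have := @one_le_modeC L m; unfold dstR; linarith

/-- `0 < r_m`. [folklore] -/
theorem dstR_pos : 0 < dstR L m := lt_of_lt_of_le one_pos one_le_modeR

/-- `r_m (c_m - √(c_m² - 1)) = 1`. [folklore] -/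
theorem dstR_mul_conj : dstR L m * (dstC L m - Real.sqrt (dstC L m ^ 2 - 1)) = 1 := by
  have h : 0 ≤ dstC L m ^ 2 - 1 := by nlinarith [@one_le_modeC L m]
  unfold dstR
  nlinarith [Real.sq_sqrt h]

/-- `r_m⁻¹ = c_m - √(c_m² - 1)`. [folklore] -/
theorem dstR_inv : (dstR L m)⁻¹ = dstC L m - Real.sqrt (dstC L m ^ 2 - 1) :=
  (eq_inv_of_mul_eq_one_right dstR_mul_conj).symm

/-- **`r_m + r_m⁻¹ = 2 c_m`.** [folklore] -/
theorem dstR_add_inv : dstR L m + (dstR L m)⁻¹ = 2 * dstC L m := by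
  rw [dstR_inv]; unfold dstR; ring

/-- The vertical profile of the `m`-th mode: `φ_m(Y) = r_m^Y - r_m^{-Y}` (a multiple of
`sinh (μ_m Y)`), vanishing at `Y = 0`. [folklore] -/
def dstProfile (L m : ℕ) (Y : ℤ) : ℝ := dstR L m ^ Y - dstR L m ^ (-Y)

/-- `φ_m(0) = 0`. [folklore] -/
@[simp] theorem dstProfile_zero : dstProfile L m 0 = 0 := by simp [dstProfile]

/-- **The vertical recurrence** `φ(Y+1) + φ(Y-1) = 2 c_m φ(Y)`. [folklore] -/
theorem dstProfile_rec (Y : ℤ) :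
    dstProfile L m (Y + 1) + dstProfile L m (Y - 1) = 2 * dstC L m * dstProfile L m Y := by
  have hr : dstR L m ≠ 0 := dstR_pos.ne'
  rw [← dstR_add_inv]
  simp only [dstProfile]
  rw [zpow_add_one₀ hr, zpow_sub_one₀ hr, neg_add, zpow_add₀ hr, show -(Y - 1) = -Y + 1 by ring, zpow_add_one₀ hr,
    zpow_neg_one]
  ring

/-- `φ_m(Y) ≥ 0` for `Y ≥ 0` (`r_m ≥ 1`). [folklore] -/
theorem dstProfile_nonneg {Y : ℤ} (hY : 0 ≤ Y) : 0 ≤ dstProfile L m Y := by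
  unfold dstProfile
  have h1 : (1 : ℝ) ≤ dstR L m ^ Y := one_le_zpow₀ one_le_modeR hY
  have h2 : dstR L m ^ (-Y) ≤ 1 := zpow_le_one_of_nonpos₀ one_le_modeR (by omega)
  linarith

/-- The horizontal mode `e_m(X) = sin(m X π/(L+1))`, vanishing at `X = 0` and `X = L + 1`. [folklore] -/
def dstSin (L m : ℕ) (X : ℤ) : ℝ := Real.sin (m * (X * (π / (L + 1))))

/-- `e_m(0) = 0`. [folklore] -/
@[simp] theorem dstSin_zero : dstSin L m 0 = 0 := by simp [dstSin]

/-- `e_m(L+1) = 0`. [folklore] -/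
theorem dstSin_width : dstSin L m (L + 1) = 0 := by
  unfold dstSin
  have : (m : ℝ) * (((L : ℤ) + 1 : ℤ) * (π / (L + 1))) = (m : ℕ) * π := by push_cast; field_simp
  rw [this]
  exact_mod_cast Real.sin_nat_mul_pi m

/-- **The horizontal recurrence** `e(X+1) + e(X-1) = 2 cos θ_m e(X)`. [folklore] -/
theorem dstSin_rec (X : ℤ) : dstSin L m (X + 1) + dstSin L m (X - 1) = 2 * Real.cos (dstAngle L m) * dstSin L m X := by
  unfold dstSin dstAngle
  push_cast
  rw [show (m : ℝ) * ((X + 1) * (π / (L + 1))) = m * (X * (π / (L + 1))) + m * (π / (L + 1)) by ring,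
    show (m : ℝ) * ((X - 1) * (π / (L + 1))) = m * (X * (π / (L + 1))) - m * (π / (L + 1)) by ring,
    Real.sin_add, Real.sin_sub]
  ring

/-- `c_m > 1` for `1 ≤ m ≤ L` (`0 < θ_m < 2π`, so `cos θ_m < 1`). [folklore] -/
theorem one_lt_modeC (hm : 1 ≤ m) (hmL : m ≤ L) : 1 < dstC L m := by
  unfold dstC dstAngle
  have h1 : 0 < (m : ℝ) * (π / (L + 1)) := by positivity
  have h2 : (m : ℝ) * (π / (L + 1)) < 2 * π := by
    have hL : (0 : ℝ) < L + 1 := by positivity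
    have : (m : ℝ) ≤ L := by exact_mod_cast hmL
    calc (m : ℝ) * (π / (L + 1)) ≤ L * (π / (L + 1)) := by gcongr
      _ < (L + 1) * (π / (L + 1)) := by gcongr; linarith
      _ = π := by field_simp
      _ < 2 * π := by linarith [Real.pi_pos]
  have hne : Real.cos (m * (π / (L + 1))) ≠ 1 := by
    rw [Ne, Real.cos_eq_one_iff_of_lt_of_lt (by linarith [Real.pi_pos]) h2]
    exact h1.ne'
  have hlt : Real.cos (m * (π / (L + 1))) < 1 := lt_of_le_of_ne (Real.cos_le_one _) hne
  linarith

/-- `r_m > 1` for `1 ≤ m ≤ L`. [folklore] -/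
theorem one_lt_modeR (hm : 1 ≤ m) (hmL : m ≤ L) : 1 < dstR L m := by
  have := Real.sqrt_nonneg (dstC L m ^ 2 - 1); have := one_lt_modeC hm hmL; unfold dstR; linarith

/-- `φ_m(Y) > 0` for `Y > 0` and `1 ≤ m ≤ L`. [folklore] -/
theorem dstProfile_pos (hm : 1 ≤ m) (hmL : m ≤ L) {Y : ℤ} (hY : 0 < Y) : 0 < dstProfile L m Y := by
  unfold dstProfile
  have hr := one_lt_modeR hm hmL
  have h1 : (1 : ℝ) < dstR L m ^ Y := one_lt_zpow₀ hr hY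
  have h2 : dstR L m ^ (-Y) < 1 := zpow_lt_one_of_neg₀ hr (by omega)
  linarith

/-! ### The sine-series solution of the Dirichlet problem on a box -/

/-- The `m`-th discrete sine coefficient of the data `d` on `{1, …, L}`:
`a_m = (2/(L+1)) ∑_{X'=1}^{L} d(X') e_m(X')`. [folklore] -/
def sineCoeff (L : ℕ) (d : ℤ → ℝ) (m : ℕ) : ℝ :=
  2 / (L + 1) * ∑ X' ∈ Finset.Icc (1 : ℤ) L, d X' * dstSin L m X'

/-- **The sine-series harmonic function of the box `{1,…,L} × {1,…,M}` with data `d` on the top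
side** `Y = M + 1` (and zero data on the three other sides):
`ψ(X, Y) = ∑_{m=0}^{L} a_m e_m(X) φ_m(Y)/φ_m(M+1)`, read as a function on `ℤ²`
(`X = v 0`, `Y = v 1`). [folklore] -/
def boxSine (L M : ℕ) (d : ℤ → ℝ) : Site 2 → ℝ := fun v =>
  ∑ m ∈ range (L + 1), sineCoeff L d m * dstSin L m (v 0) * (dstProfile L m (v 1) / dstProfile L m (M + 1))

/-- **`boxSine` is discrete harmonic on all of `ℤ²`** (each mode is: the horizontal and vertical
recurrences add up to `(2 cos θ_m + 2 c_m - 4) e φ = 0`). [folklore] -/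
theorem latticeLaplacian_boxSine (L M : ℕ) (d : ℤ → ℝ) (v : Site 2) : latticeLaplacian (boxSine L M d) v = 0 := by
  rw [latticeLaplacian, Fin.sum_univ_four]
  have c0 : (v + cornerUnit 0) 0 = v 0 + 1 ∧ (v + cornerUnit 0) 1 = v 1 := by simp [cornerUnit]
  have c1 : (v + cornerUnit 1) 0 = v 0 ∧ (v + cornerUnit 1) 1 = v 1 + 1 := by simp [cornerUnit]
  have c2 : (v + cornerUnit 2) 0 = v 0 - 1 ∧ (v + cornerUnit 2) 1 = v 1 := by simp [cornerUnit, sub_eq_add_neg]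
  have c3 : (v + cornerUnit 3) 0 = v 0 ∧ (v + cornerUnit 3) 1 = v 1 - 1 := by simp [cornerUnit, sub_eq_add_neg]
  simp only [boxSine, c0.1, c0.2, c1.1, c1.2, c2.1, c2.2, c3.1, c3.2]
  rw [← Finset.sum_sub_distrib, ← Finset.sum_sub_distrib, ← Finset.sum_sub_distrib, ← Finset.sum_sub_distrib,
    ← Finset.sum_add_distrib, ← Finset.sum_add_distrib, ← Finset.sum_add_distrib]
  refine Finset.sum_eq_zero fun m _ => ?_
  have hx := dstSin_rec (L := L) (m := m) (v 0)
  have hy := dstProfile_rec (L := L) (m := m) (v 1)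
  have hc : 2 * Real.cos (dstAngle L m) + 2 * dstC L m - 4 = 0 := by unfold dstC; ring
  set S := dstSin L m with hS
  set P := dstProfile L m with hP
  set a := sineCoeff L d m
  set D := dstProfile L m (M + 1)
  have e1 : a * S (v 0 + 1) * (P (v 1) / D) - a * S (v 0) * (P (v 1) / D) +
      (a * S (v 0) * (P (v 1 + 1) / D) - a * S (v 0) * (P (v 1) / D)) +
      (a * S (v 0 - 1) * (P (v 1) / D) - a * S (v 0) * (P (v 1) / D)) +
      (a * S (v 0) * (P (v 1 - 1) / D) - a * S (v 0) * (P (v 1) / D)) =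
      a / D * ((S (v 0 + 1) + S (v 0 - 1)) * P (v 1) + S (v 0) * (P (v 1 + 1) + P (v 1 - 1)) - 4 * S (v 0) * P (v 1)) := by
    ring
  rw [e1, hx, hy]
  have e2 : 2 * Real.cos (dstAngle L m) * S (v 0) * P (v 1) + S (v 0) * (2 * dstC L m * P (v 1)) - 4 * S (v 0) * P (v 1) =
      (2 * Real.cos (dstAngle L m) + 2 * dstC L m - 4) * (S (v 0) * P (v 1)) := by ring
  rw [e2, hc]; ring

/-- `boxSine` is harmonic on every set. [folklore] -/
theorem isLatticeHarmonicOn_boxSine (L M : ℕ) (d : ℤ → ℝ) (T : Set (Site 2)) : IsLatticeHarmonicOn (boxSine L M d) T :=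
  fun v _ => latticeLaplacian_boxSine L M d v

/-- **Boundary values, left side**: `ψ(0, Y) = 0`. [folklore] -/
theorem boxSine_left (L M : ℕ) (d : ℤ → ℝ) (v : Site 2) (hv : v 0 = 0) : boxSine L M d v = 0 := by
  simp [boxSine, hv]

/-- **Boundary values, right side**: `ψ(L+1, Y) = 0`. [folklore] -/
theorem boxSine_right (L M : ℕ) (d : ℤ → ℝ) (v : Site 2) (hv : v 0 = L + 1) : boxSine L M d v = 0 := by
  simp only [boxSine, hv]
  refine Finset.sum_eq_zero fun m _ => ?_
  rw [dstSin_width]; ring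

/-- **Boundary values, bottom side**: `ψ(X, 0) = 0`. [folklore] -/
theorem boxSine_bottom (L M : ℕ) (d : ℤ → ℝ) (v : Site 2) (hv : v 1 = 0) : boxSine L M d v = 0 := by
  simp [boxSine, hv]

/-- **Boundary values, top side: the sine series reproduces the data** (`1 ≤ X ≤ L`), by the
discrete sine orthogonality. [folklore] -/
theorem boxSine_top (L M : ℕ) (d : ℤ → ℝ) (v : Site 2) (hv : v 1 = M + 1) (hX : 1 ≤ v 0 ∧ v 0 ≤ L) :
    boxSine L M d v = d (v 0) := by
  simp only [boxSine, hv]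
  -- remove the profile factors
  have hprof : ∀ m ∈ range (L + 1), sineCoeff L d m * dstSin L m (v 0) * (dstProfile L m (M + 1) / dstProfile L m (M + 1)) =
      sineCoeff L d m * dstSin L m (v 0) := by
    intro m hm
    rcases Nat.eq_zero_or_pos m with rfl | hm0
    · simp [dstSin]
    · rw [div_self (dstProfile_pos hm0 (by rw [Finset.mem_range] at hm; omega) (by positivity)).ne', mul_one]
  rw [Finset.sum_congr rfl hprof]
  -- exchange the sums and use orthogonality
  simp only [sineCoeff]
  have : ∑ m ∈ range (L + 1), 2 / ((L : ℝ) + 1) * (∑ X' ∈ Finset.Icc (1 : ℤ) L, d X' * dstSin L m X') * dstSin L m (v 0) =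
      2 / ((L : ℝ) + 1) * ∑ X' ∈ Finset.Icc (1 : ℤ) L, d X' * ∑ m ∈ range (L + 1), dstSin L m X' * dstSin L m (v 0) := by
    rw [Finset.mul_sum]
    simp_rw [Finset.mul_sum, Finset.sum_mul]
    rw [Finset.sum_comm]
    refine Finset.sum_congr rfl fun X' _ => Finset.sum_congr rfl fun m _ => by ring
  rw [this]
  have horth : ∀ X' ∈ Finset.Icc (1 : ℤ) L, d X' * ∑ m ∈ range (L + 1), dstSin L m X' * dstSin L m (v 0) =
      if X' = v 0 then d X' * (((L : ℝ) + 1) / 2) else 0 := by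
    intro X' hX'
    rw [Finset.mem_Icc] at hX'
    simp only [dstSin]
    rw [sum_range_sin_mul_sin L hX' hX]
    split_ifs <;> ring
  rw [Finset.sum_congr rfl horth, Finset.sum_ite_eq' (Finset.Icc (1 : ℤ) L) (v 0) (fun X' => d X' * (((L : ℝ) + 1) / 2)),
    if_pos (Finset.mem_Icc.2 hX)]
  field_simp

/-! ### Analytic estimates on the modes -/

/-- `cos θ + cosh θ ≥ 2` for `θ ≥ 0` (the derivative `sinh θ - sin θ` is nonnegative). [folklore] -/
theorem two_le_cos_add_cosh {θ : ℝ} (hθ : 0 ≤ θ) : 2 ≤ Real.cos θ + Real.cosh θ := by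
  have hmono : MonotoneOn (fun t => Real.cos t + Real.cosh t) (Set.Ici 0) := by
    refine monotoneOn_of_deriv_nonneg (convex_Ici 0) ?_ ?_ ?_
    · exact (Real.continuous_cos.add Real.continuous_cosh).continuousOn
    · exact ((Real.differentiable_cos.add Real.differentiable_cosh)).differentiableOn
    · intro t ht
      rw [interior_Ici] at ht
      have hd : deriv (fun t => Real.cos t + Real.cosh t) t = -Real.sin t + Real.sinh t :=
        ((Real.hasDerivAt_cos t).add (Real.hasDerivAt_cosh t)).deriv
      rw [hd]
      have h1 : Real.sin t ≤ t := Real.sin_le ht.le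
      have h2 : t ≤ Real.sinh t := Real.self_le_sinh_iff.2 ht.le
      linarith
  have := hmono (Set.mem_Ici.2 le_rfl) (Set.mem_Ici.2 hθ) hθ
  simp only [Real.cos_zero, Real.cosh_zero] at this
  linarith

/-- The mode angle is nonnegative. [folklore] -/
theorem dstAngle_nonneg : 0 ≤ dstAngle L m := by unfold dstAngle; positivity

/-- The mode angle is at most `π` for `m ≤ L + 1`. [folklore] -/
theorem dstAngle_le_pi (hm : m ≤ L + 1) : dstAngle L m ≤ π := by
  unfold dstAngle
  have : (m : ℝ) ≤ L + 1 := by exact_mod_cast hm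
  calc (m : ℝ) * (π / (L + 1)) ≤ (L + 1) * (π / (L + 1)) := by gcongr
    _ = π := by field_simp

/-- **`r_m ≤ e^{θ_m}`**: `c_m = 2 - cos θ_m ≤ cosh θ_m` and `√(c_m² - 1) ≤ sinh θ_m`. [folklore] -/
theorem dstR_le_exp : dstR L m ≤ Real.exp (dstAngle L m) := by
  have hθ := @dstAngle_nonneg L m
  have hc : dstC L m ≤ Real.cosh (dstAngle L m) := by
    have := two_le_cos_add_cosh hθ; unfold dstC; linarith
  have hc1 := @one_le_modeC L m
  have hsq : dstC L m ^ 2 - 1 ≤ Real.sinh (dstAngle L m) ^ 2 := by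
    have h := Real.cosh_sq (dstAngle L m)
    nlinarith [Real.one_le_cosh (dstAngle L m)]
  have hs : Real.sqrt (dstC L m ^ 2 - 1) ≤ Real.sinh (dstAngle L m) := by
    rw [Real.sqrt_le_left (Real.sinh_nonneg_iff.2 hθ)]
    exact hsq
  rw [← Real.cosh_add_sinh]
  unfold dstR
  linarith

/-- For `0 ≤ s ≤ 1`, `e^s ≤ 1 + s + s²`. [folklore] -/
theorem exp_le_one_add_add_sq {s : ℝ} (hs0 : 0 ≤ s) (hs1 : s ≤ 1) : Real.exp s ≤ 1 + s + s ^ 2 := by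
  have := Real.abs_exp_sub_one_sub_id_le (x := s) (by rw [abs_of_nonneg hs0]; exact hs1)
  rw [abs_le] at this
  linarith [this.2]

/-- **`e^{0.95 θ_m} ≤ r_m` for small angles** (`θ_m ≤ 3/10`): `cosh (0.95 θ) ≤ 2 - cos θ` there, by
`cosh x ≤ e^{x²/2} ≤ 1 + x²/2 + x⁴/4` and `cos θ ≤ 1 - θ²/2 + (5/96) θ⁴`. [folklore] -/
theorem exp_le_modeR (hθ : dstAngle L m ≤ 3 / 10) : Real.exp (19 / 20 * dstAngle L m) ≤ dstR L m := by
  set θ := dstAngle L m with hθdef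
  have hθ0 : 0 ≤ θ := dstAngle_nonneg
  set y : ℝ := 19 / 20 * θ with hy
  have hy0 : 0 ≤ y := by positivity
  -- `cosh y ≤ c`
  have hcosh : Real.cosh y ≤ dstC L m := by
    have h1 : Real.cosh y ≤ Real.exp (y ^ 2 / 2) := Real.cosh_le_exp_half_sq y
    have h2 : Real.exp (y ^ 2 / 2) ≤ 1 + y ^ 2 / 2 + (y ^ 2 / 2) ^ 2 :=
      exp_le_one_add_add_sq (by positivity) (by rw [hy]; nlinarith)
    have h3 := Real.cos_bound (x := θ) (by rw [abs_of_nonneg hθ0]; linarith)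
    rw [abs_le, abs_of_nonneg hθ0] at h3
    have h4 : Real.cos θ ≤ 1 - θ ^ 2 / 2 + θ ^ 4 * (5 / 96) := by linarith [h3.2]
    unfold dstC
    rw [← hθdef]
    have h5 : y ^ 2 / 2 + (y ^ 2 / 2) ^ 2 ≤ θ ^ 2 / 2 - θ ^ 4 * (5 / 96) := by
      have hθ2 : 0 ≤ 9 / 100 - θ ^ 2 := by nlinarith
      have hA : 0 ≤ θ ^ 2 * (9 / 100 - θ ^ 2) := mul_nonneg (sq_nonneg θ) hθ2
      have hB := sq_nonneg θ
      rw [hy]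
      nlinarith
    linarith
  -- `sinh y ≤ √(c² - 1)`
  have hsinh : Real.sinh y ≤ Real.sqrt (dstC L m ^ 2 - 1) := by
    rw [Real.le_sqrt (Real.sinh_nonneg_iff.2 hy0) (by nlinarith [@one_le_modeC L m])]
    have h := Real.cosh_sq y
    nlinarith [Real.one_le_cosh y, @one_le_modeC L m]
  rw [← Real.cosh_add_sinh]
  unfold dstR
  linarith

/-- **The growth rate is monotone in the mode** (for angles up to `π`). [folklore] -/
theorem dstR_mono {m m' : ℕ} (hmm' : m ≤ m') (hm' : m' ≤ L + 1) : dstR L m ≤ dstR L m' := by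
  have hθ : dstAngle L m ≤ dstAngle L m' := by
    unfold dstAngle; gcongr
  have hc : dstC L m ≤ dstC L m' := by
    unfold dstC
    have := Real.cos_le_cos_of_nonneg_of_le_pi dstAngle_nonneg (dstAngle_le_pi hm') hθ
    linarith
  have hc1 := @one_le_modeC L m
  unfold dstR
  gcongr

/-- `sin² x ≤ x²`. [folklore] -/
theorem sin_sq_le_sq (x : ℝ) : Real.sin x ^ 2 ≤ x ^ 2 := by
  rcases le_total 0 x with hx | hx
  · rcases le_total x 1 with h1 | h1
    · have := Real.sin_le hx
      have : 0 ≤ Real.sin x := by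
        have := Real.mul_le_sin hx (h1.trans (by linarith [Real.pi_gt_three]))
        have : 0 ≤ 2 / π * x := by positivity
        linarith
      nlinarith
    · nlinarith [Real.sin_sq_le_one x]
  · rcases le_total (-1) x with h1 | h1
    · have h := Real.sin_le (neg_nonneg.2 hx)
      rw [Real.sin_neg] at h
      have : Real.sin x ≤ 0 := by
        have := Real.mul_le_sin (neg_nonneg.2 hx) (by linarith [Real.pi_gt_three])
        rw [Real.sin_neg] at this
        have : 0 ≤ 2 / π * -x := mul_nonneg (by positivity) (neg_nonneg.2 hx)
        linarith
      nlinarith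
    · nlinarith [Real.sin_sq_le_one x]

/-- `c_m - 1 = 1 - cos θ_m = 2 sin²(θ_m/2)`. [folklore] -/
theorem dstC_sub_one : dstC L m - 1 = 2 * Real.sin (dstAngle L m / 2) ^ 2 := by
  unfold dstC
  rw [Real.sin_sq_eq_half_sub, show 2 * (dstAngle L m / 2) = dstAngle L m by ring]
  ring

/-- **The size of the first step of a mode**: `φ_m(1) = 2 √(c_m² - 1)`. [folklore] -/
theorem dstProfile_one : dstProfile L m 1 = 2 * Real.sqrt (dstC L m ^ 2 - 1) := by
  unfold dstProfile
  rw [zpow_one, zpow_neg, zpow_one, dstR_inv]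
  unfold dstR; ring

/-- Upper bound `φ_m(1) ≤ 3 θ_m` (`c_m² - 1 ≤ 4 (c_m - 1) = 8 sin²(θ_m/2) ≤ 2 θ_m²`). [folklore] -/
theorem dstProfile_one_le : dstProfile L m 1 ≤ 3 * dstAngle L m := by
  rw [dstProfile_one]
  have hθ := @dstAngle_nonneg L m
  have h1 : dstC L m ^ 2 - 1 ≤ 2 * dstAngle L m ^ 2 := by
    have hc := @dstC_sub_one L m
    have hc3 := @dstC_le_three L m
    have hc1 := @one_le_modeC L m
    have hs := sin_sq_le_sq (dstAngle L m / 2)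
    nlinarith
  have h2 : Real.sqrt (dstC L m ^ 2 - 1) ≤ Real.sqrt 2 * dstAngle L m := by
    rw [Real.sqrt_le_left (by positivity), mul_pow, Real.sq_sqrt zero_le_two]
    exact h1
  have h3 : Real.sqrt 2 ≤ 3 / 2 := by
    rw [Real.sqrt_le_left (by norm_num)]; norm_num
  nlinarith

/-- Lower bound for the first mode: `φ₁(1) ≥ 4/(L+1)` (`c₁² - 1 ≥ 2(c₁ - 1) = 4 sin²(θ₁/2)`
and `sin (θ₁/2) ≥ θ₁/π`). [folklore] -/
theorem le_modeProfile_one_first : 4 / ((L : ℝ) + 1) ≤ dstProfile L 1 1 := by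
  rw [dstProfile_one]
  have hθ : dstAngle L 1 = π / (L + 1) := by unfold dstAngle; simp
  have hL : (0 : ℝ) < L + 1 := by positivity
  have hsin : 1 / ((L : ℝ) + 1) ≤ Real.sin (dstAngle L 1 / 2) := by
    have h := Real.mul_le_sin (x := dstAngle L 1 / 2) (by rw [hθ]; positivity)
      (by rw [hθ]; exact div_le_div_of_nonneg_right (div_le_self Real.pi_pos.le (by linarith)) two_pos.le)
    rw [hθ] at h ⊢
    have : 2 / π * (π / (L + 1) / 2) = 1 / (L + 1) := by field_simp
    linarith [this]
  have h1 : (2 / ((L : ℝ) + 1)) ^ 2 ≤ dstC L 1 ^ 2 - 1 := by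
    have hc := @dstC_sub_one L 1
    have hc1 := @one_le_modeC L 1
    have hpos : 0 ≤ 1 / ((L : ℝ) + 1) := by positivity
    have hs2 : (1 / ((L : ℝ) + 1)) ^ 2 ≤ Real.sin (dstAngle L 1 / 2) ^ 2 := pow_le_pow_left₀ hpos hsin 2
    have e : (2 / ((L : ℝ) + 1)) ^ 2 = 4 * (1 / ((L : ℝ) + 1)) ^ 2 := by ring
    rw [e]
    nlinarith
  have h2 : 2 / ((L : ℝ) + 1) ≤ Real.sqrt (dstC L 1 ^ 2 - 1) := Real.le_sqrt_of_sq_le h1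
  have e : (4 : ℝ) / (L + 1) = 2 * (2 / (L + 1)) := by ring
  rw [e]
  linarith

/-- `sin t ≥ 1/2` on `[π/4, 3π/4]`. [folklore] -/
theorem half_le_sin {t : ℝ} (h1 : π / 4 ≤ t) (h2 : t ≤ 3 * π / 4) : 1 / 2 ≤ Real.sin t := by
  rcases le_total t (π / 2) with h | h
  · have := Real.mul_le_sin (x := t) (by linarith [Real.pi_pos]) h
    have : 2 / π * (π / 4) ≤ 2 / π * t := by gcongr
    have : 2 / π * (π / 4) = 1 / 2 := by field_simp; ring
    linarith
  · rw [← Real.sin_pi_sub]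
    have := Real.mul_le_sin (x := π - t) (by linarith) (by linarith)
    have : 2 / π * (π / 4) ≤ 2 / π * (π - t) := by gcongr; linarith
    have : 2 / π * (π / 4) = 1 / 2 := by field_simp; ring
    linarith

/-! ### Window data on the top side -/

/-- The data `γ · 1_{X₀ ≤ X ≤ X₀ + 2}`: a window of three cells at height `γ`. [folklore] -/
def windowData (γ : ℝ) (X₀ : ℤ) : ℤ → ℝ := fun X => if X₀ ≤ X ∧ X ≤ X₀ + 2 then γ else 0

/-- The sine coefficients of window data. [folklore] -/
theorem sineCoeff_windowData (L : ℕ) (γ : ℝ) {X₀ : ℤ} (h1 : 1 ≤ X₀) (h2 : X₀ + 2 ≤ L) (m : ℕ) :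
    sineCoeff L (windowData γ X₀) m =
      2 / ((L : ℝ) + 1) * (γ * (dstSin L m X₀ + dstSin L m (X₀ + 1) + dstSin L m (X₀ + 2))) := by
  unfold sineCoeff windowData
  congr 1
  have hsub : Finset.Icc X₀ (X₀ + 2) ⊆ Finset.Icc (1 : ℤ) L := by
    intro X hX; rw [Finset.mem_Icc] at hX ⊢; omega
  rw [← Finset.sum_subset hsub (fun X hX hXw => by
    rw [Finset.mem_Icc] at hX hXw
    rw [if_neg (by omega), zero_mul])]
  have hIcc : Finset.Icc X₀ (X₀ + 2) = {X₀, X₀ + 1, X₀ + 2} := by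
    ext X; simp only [Finset.mem_Icc, Finset.mem_insert, Finset.mem_singleton]; omega
  rw [hIcc, Finset.sum_insert (by simp), Finset.sum_insert (by simp), Finset.sum_singleton,
    if_pos ⟨le_rfl, by omega⟩, if_pos ⟨by omega, by omega⟩, if_pos ⟨by omega, le_rfl⟩]
  ring

/-- `|a_m| ≤ 6γ/(L+1)` for window data (`γ ≥ 0`). [folklore] -/
theorem abs_sineCoeff_windowData_le (L : ℕ) {γ : ℝ} (hγ : 0 ≤ γ) {X₀ : ℤ} (h1 : 1 ≤ X₀) (h2 : X₀ + 2 ≤ L) (m : ℕ) :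
    |sineCoeff L (windowData γ X₀) m| ≤ 6 * γ / ((L : ℝ) + 1) := by
  rw [sineCoeff_windowData L γ h1 h2 m, abs_mul, abs_of_nonneg (by positivity : (0 : ℝ) ≤ 2 / ((L : ℝ) + 1)), abs_mul,
    abs_of_nonneg hγ]
  have hs : |dstSin L m X₀ + dstSin L m (X₀ + 1) + dstSin L m (X₀ + 2)| ≤ 3 := by
    have a1 := Real.abs_sin_le_one (m * (X₀ * (π / (L + 1))))
    have a2 := Real.abs_sin_le_one (m * ((X₀ + 1 : ℤ) * (π / (L + 1))))
    have a3 := Real.abs_sin_le_one (m * ((X₀ + 2 : ℤ) * (π / (L + 1))))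
    unfold dstSin
    calc |Real.sin (m * (X₀ * (π / (L + 1)))) + Real.sin (m * ((X₀ + 1 : ℤ) * (π / (L + 1)))) +
          Real.sin (m * ((X₀ + 2 : ℤ) * (π / (L + 1))))|
        ≤ |Real.sin (m * (X₀ * (π / (L + 1)))) + Real.sin (m * ((X₀ + 1 : ℤ) * (π / (L + 1))))| +
          |Real.sin (m * ((X₀ + 2 : ℤ) * (π / (L + 1))))| := abs_add_le _ _
      _ ≤ (|Real.sin (m * (X₀ * (π / (L + 1))))| + |Real.sin (m * ((X₀ + 1 : ℤ) * (π / (L + 1))))|) +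
          |Real.sin (m * ((X₀ + 2 : ℤ) * (π / (L + 1))))| := by gcongr; exact abs_add_le _ _
      _ ≤ 3 := by linarith
  have hL : (0 : ℝ) < L + 1 := by positivity
  calc 2 / ((L : ℝ) + 1) * (γ * |dstSin L m X₀ + dstSin L m (X₀ + 1) + dstSin L m (X₀ + 2)|)
      ≤ 2 / ((L : ℝ) + 1) * (γ * 3) := by gcongr
    _ = 6 * γ / ((L : ℝ) + 1) := by ring

/-- **The first coefficient of a window in the middle half is large**: `a₁ ≥ 3γ/(L+1)` when
`(L+1)/4 ≤ X₀` and `X₀ + 2 ≤ 3(L+1)/4` (each of the three sines is at least `1/2`). [folklore] -/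
theorem le_sineCoeff_windowData_one (L : ℕ) {γ : ℝ} (hγ : 0 ≤ γ) {X₀ : ℤ} (h1 : 1 ≤ X₀) (h2 : X₀ + 2 ≤ L)
    (hX₀ : ((L : ℝ) + 1) / 4 ≤ X₀) (hX₀' : (X₀ : ℝ) + 2 ≤ 3 * ((L : ℝ) + 1) / 4) :
    3 * γ / ((L : ℝ) + 1) ≤ sineCoeff L (windowData γ X₀) 1 := by
  rw [sineCoeff_windowData L γ h1 h2 1]
  have hL : (0 : ℝ) < L + 1 := by positivity
  have key : ∀ X : ℤ, ((L : ℝ) + 1) / 4 ≤ X → (X : ℝ) ≤ 3 * ((L : ℝ) + 1) / 4 → 1 / 2 ≤ dstSin L 1 X := by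
    intro X hXl hXu
    unfold dstSin
    simp only [Nat.cast_one, one_mul]
    refine half_le_sin ?_ ?_
    · rw [show π / 4 = ((L : ℝ) + 1) / 4 * (π / (L + 1)) by field_simp]
      exact mul_le_mul_of_nonneg_right hXl (by positivity)
    · rw [show 3 * π / 4 = 3 * ((L : ℝ) + 1) / 4 * (π / (L + 1)) by field_simp]
      exact mul_le_mul_of_nonneg_right hXu (by positivity)
  have s0 := key X₀ hX₀ (by linarith)
  have s1 := key (X₀ + 1) (by push_cast; linarith) (by push_cast; linarith)
  have s2 := key (X₀ + 2) (by push_cast; linarith) (by push_cast; linarith)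
  calc 3 * γ / ((L : ℝ) + 1) = 2 / ((L : ℝ) + 1) * (γ * (1 / 2 + 1 / 2 + 1 / 2)) := by ring
    _ ≤ 2 / ((L : ℝ) + 1) * (γ * (dstSin L 1 X₀ + dstSin L 1 (X₀ + 1) + dstSin L 1 (X₀ + 2))) := by gcongr

/-! ### Bounds on the terms of the series -/

/-- The vertical attenuation of the first mode in a box of aspect at most `4`:
`φ₁(1)/φ₁(M+1) ≥ 4 e^{-4π}/(L+1)`. [folklore] -/
theorem le_modeProfile_ratio_first {L M : ℕ} (hL : 1 ≤ L) (hM' : M + 1 ≤ 4 * (L + 1)) :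
    4 * Real.exp (-(4 * π)) / ((L : ℝ) + 1) ≤ dstProfile L 1 1 / dstProfile L 1 (M + 1) := by
  have hpos : 0 < dstProfile L 1 (M + 1) := dstProfile_pos le_rfl hL (by positivity)
  have hup : dstProfile L 1 (M + 1) ≤ Real.exp (4 * π) := by
    unfold dstProfile
    have h1 : dstR L 1 ^ ((M : ℤ) + 1) ≤ Real.exp (4 * π) := by
      rw [show ((M : ℤ) + 1) = ((M + 1 : ℕ) : ℤ) by push_cast; ring, zpow_natCast]
      calc dstR L 1 ^ (M + 1) ≤ Real.exp (dstAngle L 1) ^ (M + 1) :=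
            pow_le_pow_left₀ dstR_pos.le dstR_le_exp _
        _ = Real.exp ((M + 1 : ℕ) * dstAngle L 1) := by rw [← Real.exp_nat_mul]
        _ ≤ Real.exp (4 * π) := by
            rw [Real.exp_le_exp]
            unfold dstAngle
            have : ((M + 1 : ℕ) : ℝ) ≤ 4 * (L + 1) := by exact_mod_cast hM'
            calc ((M + 1 : ℕ) : ℝ) * ((1 : ℕ) * (π / (L + 1))) ≤ 4 * (L + 1) * ((1 : ℕ) * (π / (L + 1))) := by
                  gcongr
              _ = 4 * π := by simp; field_simp
    have h2 : 0 ≤ dstR L 1 ^ (-((M : ℤ) + 1)) := zpow_nonneg dstR_pos.le _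
    linarith
  have hlow := le_modeProfile_one_first (L := L)
  rw [le_div_iff₀ hpos]
  calc 4 * Real.exp (-(4 * π)) / ((L : ℝ) + 1) * dstProfile L 1 (M + 1)
      ≤ 4 * Real.exp (-(4 * π)) / ((L : ℝ) + 1) * Real.exp (4 * π) := by gcongr
    _ = 4 / ((L : ℝ) + 1) := by rw [Real.exp_neg]; field_simp
    _ ≤ dstProfile L 1 1 := hlow

/-- **The main term**: for window and observation point in the middle half and aspect at most
`4`, the first mode contributes at least `6 e^{-4π} γ/(L+1)²` at height `1`. [folklore] -/
theorem first_term_lower_bound {L M : ℕ} (hL : 1 ≤ L) (hM' : M + 1 ≤ 4 * (L + 1)) {γ : ℝ} (hγ : 0 ≤ γ)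
    {X₀ X₁ : ℤ} (h1 : 1 ≤ X₀) (h2 : X₀ + 2 ≤ L)
    (hX₀ : ((L : ℝ) + 1) / 4 ≤ X₀) (hX₀' : (X₀ : ℝ) + 2 ≤ 3 * ((L : ℝ) + 1) / 4)
    (hX₁ : ((L : ℝ) + 1) / 4 ≤ X₁) (hX₁' : (X₁ : ℝ) ≤ 3 * ((L : ℝ) + 1) / 4) :
    6 * Real.exp (-(4 * π)) * γ / ((L : ℝ) + 1) ^ 2 ≤
      sineCoeff L (windowData γ X₀) 1 * dstSin L 1 X₁ * (dstProfile L 1 1 / dstProfile L 1 (M + 1)) := by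
  have ha := le_sineCoeff_windowData_one L hγ h1 h2 hX₀ hX₀'
  have hs : 1 / 2 ≤ dstSin L 1 X₁ := by
    unfold dstSin; simp only [Nat.cast_one, one_mul]
    have hLp : (0 : ℝ) < L + 1 := by positivity
    refine half_le_sin ?_ ?_
    · rw [show π / 4 = ((L : ℝ) + 1) / 4 * (π / (L + 1)) by field_simp]
      exact mul_le_mul_of_nonneg_right hX₁ (by positivity)
    · rw [show 3 * π / 4 = 3 * ((L : ℝ) + 1) / 4 * (π / (L + 1)) by field_simp]
      exact mul_le_mul_of_nonneg_right hX₁' (by positivity)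
  have hr := le_modeProfile_ratio_first hL hM'
  have h0a : 0 ≤ 3 * γ / ((L : ℝ) + 1) := by positivity
  have h0r : 0 ≤ 4 * Real.exp (-(4 * π)) / ((L : ℝ) + 1) := by positivity
  have hL0 : (0 : ℝ) < L + 1 := by positivity
  calc 6 * Real.exp (-(4 * π)) * γ / ((L : ℝ) + 1) ^ 2
      = 3 * γ / ((L : ℝ) + 1) * (1 / 2) * (4 * Real.exp (-(4 * π)) / ((L : ℝ) + 1)) := by
        field_simp; ring
    _ ≤ sineCoeff L (windowData γ X₀) 1 * dstSin L 1 X₁ * (dstProfile L 1 1 / dstProfile L 1 (M + 1)) := by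
        apply mul_le_mul (mul_le_mul ha hs (by norm_num) (h0a.trans ha)) hr h0r
        exact mul_nonneg (h0a.trans ha) (le_trans (by norm_num) hs)

/-- **A tail term**: `|T_m| ≤ (6γ/(L+1)) · 3θ_m · (2 / r_m^{M+1})` as soon as `r_m^{M+1} ≥ 2`. [folklore] -/
theorem abs_term_le {L M : ℕ} {γ : ℝ} (hγ : 0 ≤ γ) {X₀ : ℤ} (h1 : 1 ≤ X₀) (h2 : X₀ + 2 ≤ L) (X₁ : ℤ) {m : ℕ}
    (hm : 1 ≤ m) (hmL : m ≤ L) (hbig : 2 ≤ dstR L m ^ (M + 1)) :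
    |sineCoeff L (windowData γ X₀) m * dstSin L m X₁ * (dstProfile L m 1 / dstProfile L m (M + 1))| ≤
      6 * γ / ((L : ℝ) + 1) * (3 * dstAngle L m) * (2 / dstR L m ^ (M + 1)) := by
  have hD : dstR L m ^ (M + 1) / 2 ≤ dstProfile L m (M + 1) := by
    unfold dstProfile
    rw [show ((M : ℤ) + 1) = ((M + 1 : ℕ) : ℤ) by push_cast; ring, zpow_natCast, zpow_neg, zpow_natCast]
    have : (dstR L m ^ (M + 1))⁻¹ ≤ 1 := inv_le_one_of_one_le₀ (one_le_pow₀ one_le_modeR)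
    linarith
  have hDpos : 0 < dstProfile L m (M + 1) := dstProfile_pos hm hmL (by positivity)
  have hN : dstProfile L m 1 ≤ 3 * dstAngle L m := dstProfile_one_le
  have hN0 : 0 ≤ dstProfile L m 1 := dstProfile_nonneg zero_le_one
  rw [abs_mul, abs_mul, abs_of_nonneg (div_nonneg hN0 hDpos.le)]
  have hs : |dstSin L m X₁| ≤ 1 := Real.abs_sin_le_one _
  have ha := abs_sineCoeff_windowData_le L hγ h1 h2 m
  have hratio : dstProfile L m 1 / dstProfile L m (M + 1) ≤ 3 * dstAngle L m * (2 / dstR L m ^ (M + 1)) := by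
    rw [div_le_iff₀ hDpos]
    have hRpos : 0 < dstR L m ^ (M + 1) := pow_pos dstR_pos _
    calc dstProfile L m 1 ≤ 3 * dstAngle L m := hN
      _ = 3 * dstAngle L m * (2 / dstR L m ^ (M + 1)) * (dstR L m ^ (M + 1) / 2) := by field_simp
      _ ≤ 3 * dstAngle L m * (2 / dstR L m ^ (M + 1)) * dstProfile L m (M + 1) := by
          have : 0 ≤ 3 * dstAngle L m * (2 / dstR L m ^ (M + 1)) := by
            have := @dstAngle_nonneg L m; positivity
          exact mul_le_mul_of_nonneg_left hD this
  calc |sineCoeff L (windowData γ X₀) m| * |dstSin L m X₁| * (dstProfile L m 1 / dstProfile L m (M + 1))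
      ≤ 6 * γ / ((L : ℝ) + 1) * 1 * (3 * dstAngle L m * (2 / dstR L m ^ (M + 1))) := by
        gcongr
    _ = 6 * γ / ((L : ℝ) + 1) * (3 * dstAngle L m) * (2 / dstR L m ^ (M + 1)) := by ring

/-! ### Numerical constants -/

/-- `e ≥ 2.7`. [folklore] -/
theorem exp_one_ge : (27 / 10 : ℝ) ≤ Real.exp 1 := by
  have := Real.exp_one_gt_d9; linarith

/-- `e^5 ≥ 143`. [folklore] -/
theorem exp_five_ge : (143 : ℝ) ≤ Real.exp 5 := by
  have h : Real.exp 5 = Real.exp 1 ^ 5 := by rw [← Real.exp_nat_mul]; norm_num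
  rw [h]
  calc (143 : ℝ) ≤ (27 / 10) ^ 5 := by norm_num
    _ ≤ Real.exp 1 ^ 5 := pow_le_pow_left₀ (by norm_num) exp_one_ge 5

/-- `e^8 ≥ 2800`. [folklore] -/
theorem exp_eight_ge : (2800 : ℝ) ≤ Real.exp 8 := by
  have h : Real.exp 8 = Real.exp 1 ^ 8 := by rw [← Real.exp_nat_mul]; norm_num
  rw [h]
  calc (2800 : ℝ) ≤ (27 / 10) ^ 8 := by norm_num
    _ ≤ Real.exp 1 ^ 8 := pow_le_pow_left₀ (by norm_num) exp_one_ge 8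

/-- `x ≤ e^{x/8}` for `x ≥ 40`. [folklore] -/
theorem le_exp_div_eight {x : ℝ} (hx : 40 ≤ x) : x ≤ Real.exp (x / 8) := by
  have h1 : Real.exp (x / 8) = Real.exp 5 * Real.exp ((x - 40) / 8) := by
    rw [← Real.exp_add]; congr 1; ring
  have h2 : (x - 40) / 8 + 1 ≤ Real.exp ((x - 40) / 8) := Real.add_one_le_exp _
  have h3 := exp_five_ge
  rw [h1]
  nlinarith [Real.exp_pos ((x - 40) / 8)]

/-- A geometric tail: for `0 ≤ q ≤ 1/2`, `∑_{m ∈ s} q^m ≤ 2 q²` over any finite set of exponents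
`≥ 2`. [folklore] -/
theorem sum_pow_le_of_two_le {q : ℝ} (hq0 : 0 ≤ q) (hq : q ≤ 1 / 2) (s : Finset ℕ) (hs : ∀ m ∈ s, 2 ≤ m) :
    ∑ m ∈ s, q ^ m ≤ 2 * q ^ 2 := by
  -- compare with the full geometric series from `2`
  obtain ⟨K, hK⟩ : ∃ K, ∀ m ∈ s, m < K := ⟨s.sup id + 1, fun m hm => Nat.lt_succ_of_le (Finset.le_sup (f := id) hm)⟩
  have hsub : s ⊆ Finset.Ico 2 K := fun m hm => Finset.mem_Ico.2 ⟨hs m hm, hK m hm⟩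
  calc ∑ m ∈ s, q ^ m ≤ ∑ m ∈ Finset.Ico 2 K, q ^ m :=
        Finset.sum_le_sum_of_subset_of_nonneg hsub fun m _ _ => pow_nonneg hq0 m
    _ ≤ 2 * q ^ 2 := by
        rcases lt_or_ge K 2 with hK2 | hK2
        · rw [Finset.Ico_eq_empty_of_le hK2.le, Finset.sum_empty]; positivity
        · have hq1 : q ≠ 1 := by linarith
          rw [geom_sum_Ico hq1 hK2]
          have h1q : 0 < 1 - q := by linarith
          rw [div_le_iff_of_neg (by linarith), show 2 * q ^ 2 * (q - 1) = 2 * q ^ 3 - 2 * q ^ 2 by ring]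
          have hK0 : 0 ≤ q ^ K := pow_nonneg hq0 K
          have h3 : 2 * q ^ 3 - q ^ 2 ≤ 0 := by
            have : q ^ 3 = q ^ 2 * q := by ring
            rw [this]
            nlinarith [sq_nonneg q]
          linarith

/-! ### The lower bound at the bottom of a tall box under a window in the top side -/

set_option maxHeartbeats 800000 in
/-- **Main estimate.** For a box of width `L ≥ 40` and height `M` with `7(L+1) ≤ 2(M+1) ≤ 8(L+1)`
(aspect ratio between `7/2` and `4`), nonnegative window data `γ · 1_{[X₀, X₀+2]}` on the top
side with the window in the middle half, and an observation column `X₁` in the middle half, the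
sine-series harmonic function satisfies `ψ(X₁, 1) ≥ 3 e^{-4π} γ/(L+1)²`: the first Fourier mode
dominates, all others being suppressed by `(r₁/r_m)^{M+1}`. This is the quantitative
harmonic-measure lower bound "the harmonic measure of the wired point seen from `x` is of order
`1/n²`" behind Duminil-Copin–Hongler–Nolin's Lemma 9 / Proposition 13, in the form needed by the
tree (a subsolution for the comparison principle of `LatticeLaplacian.lean`).
[cite: DuminilCopinHonglerNolin2011, §3.2 Lemma 9 and §4 Proposition 13] -/
theorem boxSine_window_lower_bound {L M : ℕ} (hL : 40 ≤ L) (hM : 7 * (L + 1) ≤ 2 * (M + 1)) (hM' : M + 1 ≤ 4 * (L + 1))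
    {γ : ℝ} (hγ : 0 ≤ γ) {X₀ X₁ : ℤ}
    (hX₀ : ((L : ℝ) + 1) / 4 ≤ X₀) (hX₀' : (X₀ : ℝ) + 2 ≤ 3 * ((L : ℝ) + 1) / 4)
    (hX₁ : ((L : ℝ) + 1) / 4 ≤ X₁) (hX₁' : (X₁ : ℝ) ≤ 3 * ((L : ℝ) + 1) / 4) :
    3 * Real.exp (-(4 * π)) * γ / ((L : ℝ) + 1) ^ 2 ≤ boxSine L M (windowData γ X₀) ![X₁, 1] := by
  have hLr : (40 : ℝ) ≤ L := by exact_mod_cast hL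
  have hL1 : (0 : ℝ) < L + 1 := by positivity
  have hπ : (157 / 50 : ℝ) < π := by have := Real.pi_gt_d2; norm_num at this; exact this
  have hπ' : π < (63 / 20 : ℝ) := by have := Real.pi_lt_d2; norm_num at this; exact this
  -- the window lies in `[1, L]`
  have h1 : 1 ≤ X₀ := by
    have : (1 : ℝ) ≤ X₀ := by linarith
    exact_mod_cast this
  have h2 : X₀ + 2 ≤ L := by
    have : (X₀ : ℝ) + 2 ≤ L := by linarith
    exact_mod_cast this
  -- the terms
  set T : ℕ → ℝ := fun m =>
    sineCoeff L (windowData γ X₀) m * dstSin L m X₁ * (dstProfile L m 1 / dstProfile L m (M + 1)) with hT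
  have hbox : boxSine L M (windowData γ X₀) ![X₁, 1] = ∑ m ∈ range (L + 1), T m := by
    simp [boxSine, hT]
  rw [hbox]
  -- split `range (L+1) = {0, 1} ∪ [2, m₀] ∪ (m₀, L]`
  set m₀ : ℕ := (L + 1) / 11 with hm₀
  have hm₀1 : 3 ≤ m₀ := by omega
  have hm₀L : m₀ ≤ L := by omega
  have h11 : L + 1 - 10 ≤ 11 * m₀ := by omega
  rw [Finset.range_eq_Ico, ← Finset.sum_Ico_consecutive T (show 0 ≤ 2 by norm_num) (show 2 ≤ L + 1 by omega),
    ← Finset.sum_Ico_consecutive T (show 2 ≤ m₀ + 1 by omega) (show m₀ + 1 ≤ L + 1 by omega)]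
  have h01 : ∑ m ∈ Finset.Ico 0 2, T m = T 1 := by
    rw [Finset.sum_Ico_succ_top (by norm_num), Finset.sum_Ico_succ_top (by norm_num), Finset.Ico_self, Finset.sum_empty]
    have : T 0 = 0 := by
      simp only [hT]
      rw [show dstSin L 0 X₁ = 0 by simp [dstSin]]
      ring
    rw [this]; ring
  rw [h01]
  -- aspect ratio as a real inequality
  have haspect : (7 / 2 : ℝ) ≤ ((M : ℝ) + 1) / (L + 1) := by
    rw [le_div_iff₀ hL1]
    have : (7 * (L + 1) : ℝ) ≤ 2 * (M + 1) := by exact_mod_cast hM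
    linarith
  -- `r_m^{M+1} ≥ exp (0.95 θ_m (M+1))` for `θ_m ≤ 3/10`
  have hpow : ∀ m : ℕ, dstAngle L m ≤ 3 / 10 →
      Real.exp (19 / 20 * dstAngle L m * ((M : ℝ) + 1)) ≤ dstR L m ^ (M + 1) := by
    intro m hm
    calc Real.exp (19 / 20 * dstAngle L m * ((M : ℝ) + 1)) = Real.exp (19 / 20 * dstAngle L m) ^ (M + 1) := by
          rw [← Real.exp_nat_mul]; congr 1; push_cast; ring
      _ ≤ dstR L m ^ (M + 1) := pow_le_pow_left₀ (Real.exp_pos _).le (exp_le_modeR hm) _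
  -- the angle of `m₀`
  have hθm₀ : dstAngle L m₀ ≤ 3 / 10 := by
    unfold dstAngle
    have hc : (m₀ : ℝ) * 11 ≤ L + 1 := by
      have : m₀ * 11 ≤ L + 1 := by omega
      exact_mod_cast this
    rw [show (m₀ : ℝ) * (π / (L + 1)) = m₀ * π / (L + 1) by ring, div_le_iff₀ hL1]
    have s1 : (m₀ : ℝ) * 11 * π ≤ (L + 1) * π := mul_le_mul_of_nonneg_right hc Real.pi_pos.le
    have s2 : ((L : ℝ) + 1) * π ≤ (L + 1) * (63 / 20) := mul_le_mul_of_nonneg_left hπ'.le hL1.le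
    nlinarith [s1, s2]
  have hθm₀' : (19 / 20 * (7 / 2) * π / 11) * ((L : ℝ) - 9) ≤ 19 / 20 * dstAngle L m₀ * ((M : ℝ) + 1) := by
    unfold dstAngle
    have hc : (L : ℝ) - 9 ≤ 11 * m₀ := by
      have : (((L + 1 - 10 : ℕ)) : ℝ) ≤ 11 * m₀ := by exact_mod_cast h11
      have e : (((L + 1 - 10 : ℕ)) : ℝ) = L - 9 := by
        rw [Nat.cast_sub (by omega)]; push_cast; ring
      linarith
    have hm₀r : (0 : ℝ) ≤ m₀ := by positivity
    -- `θ_{m₀} (M+1) = m₀ π (M+1)/(L+1) ≥ m₀ π 7/2 ≥ (L-9) π 7/22`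
    have step : m₀ * π * (7 / 2) ≤ (m₀ : ℝ) * (π / (L + 1)) * ((M : ℝ) + 1) := by
      rw [show (m₀ : ℝ) * (π / (L + 1)) * ((M : ℝ) + 1) = m₀ * π * ((M + 1) / (L + 1)) by ring]
      exact mul_le_mul_of_nonneg_left haspect (mul_nonneg hm₀r Real.pi_pos.le)
    have step2 : ((L : ℝ) - 9) * π * (7 / 2) ≤ 11 * m₀ * π * (7 / 2) := by
      have := mul_le_mul_of_nonneg_right hc (mul_nonneg Real.pi_pos.le (by norm_num : (0 : ℝ) ≤ 7 / 2))
      nlinarith [this]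
    have e : 19 / 20 * (7 / 2) * π / 11 * ((L : ℝ) - 9) = 19 / 20 * (((L : ℝ) - 9) * π * (7 / 2)) / 11 := by ring
    rw [e]
    have e2 : 19 / 20 * ((m₀ : ℝ) * (π / (L + 1))) * ((M : ℝ) + 1) = 19 / 20 * ((m₀ : ℝ) * (π / (L + 1)) * ((M : ℝ) + 1)) := by ring
    rw [e2]
    have : ((L : ℝ) - 9) * π * (7 / 2) / 11 ≤ (m₀ : ℝ) * (π / (L + 1)) * ((M : ℝ) + 1) := by
      rw [div_le_iff₀ (by norm_num : (0 : ℝ) < 11)]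
      nlinarith [step, step2]
    linarith
  -- **Case A**: the modes `2 ≤ m ≤ m₀`
  set a : ℝ := 19 / 20 * (7 / 2) * π with ha
  have ha10 : 10 ≤ a := by rw [ha]; linarith
  have hA : ∀ m ∈ Finset.Ico 2 (m₀ + 1), |T m| ≤ 36 * π * γ / ((L : ℝ) + 1) ^ 2 * (2 * Real.exp (-a)) ^ m := by
    intro m hm
    rw [Finset.mem_Ico] at hm
    have hmθ : dstAngle L m ≤ 3 / 10 := by
      refine le_trans ?_ hθm₀
      unfold dstAngle; gcongr; omega
    have hexp : Real.exp (a * m) ≤ dstR L m ^ (M + 1) := by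
      refine le_trans ?_ (hpow m hmθ)
      rw [Real.exp_le_exp, ha]
      unfold dstAngle
      have hmr : (0 : ℝ) ≤ m := by positivity
      rw [show 19 / 20 * (m * (π / ((L : ℝ) + 1))) * ((M : ℝ) + 1) = 19 / 20 * (m * π) * ((M + 1) / (L + 1)) by ring,
        show 19 / 20 * (7 / 2) * π * (m : ℝ) = 19 / 20 * (m * π) * (7 / 2) by ring]
      exact mul_le_mul_of_nonneg_left haspect (by positivity)
    have hbig : 2 ≤ dstR L m ^ (M + 1) := by
      refine le_trans ?_ hexp
      have : (1 : ℝ) + 1 ≤ Real.exp (a * m) := by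
        have h := Real.add_one_le_exp (a * m)
        have : (1 : ℝ) ≤ a * m := by
          have : (2 : ℝ) ≤ m := by exact_mod_cast hm.1
          nlinarith
        linarith
      linarith
    refine (abs_term_le hγ h1 h2 X₁ (by omega) (by omega) hbig).trans ?_
    -- `6γ/(L+1) · 3θ_m · 2/r^{M+1} ≤ 36πγ/(L+1)² · (2e^{-a})^m`, using `2/r^{M+1} ≤ 2 e^{-am}` and `θ_m = mπ/(L+1) ≤ 2^m π/(L+1)`
    have hr : 2 / dstR L m ^ (M + 1) ≤ 2 * Real.exp (-(a * m)) := by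
      rw [Real.exp_neg, ← div_eq_mul_inv]
      exact div_le_div_of_nonneg_left (by norm_num) (Real.exp_pos _) hexp
    have hm2 : (m : ℝ) ≤ 2 ^ m := by exact_mod_cast (Nat.lt_two_pow_self).le
    have hθ : 3 * dstAngle L m ≤ 3 * (2 ^ m * (π / (L + 1))) := by
      unfold dstAngle; gcongr
    calc 6 * γ / ((L : ℝ) + 1) * (3 * dstAngle L m) * (2 / dstR L m ^ (M + 1))
        ≤ 6 * γ / ((L : ℝ) + 1) * (3 * (2 ^ m * (π / (L + 1)))) * (2 * Real.exp (-(a * m))) := by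
          gcongr
      _ = 36 * π * γ / ((L : ℝ) + 1) ^ 2 * (2 * Real.exp (-a)) ^ m := by
          rw [mul_pow, show Real.exp (-(a * m)) = Real.exp (-a) ^ m by rw [← Real.exp_nat_mul]; congr 1; ring]
          field_simp
          ring
  have hsumA : ∑ m ∈ Finset.Ico 2 (m₀ + 1), |T m| ≤ 3 / 2 * (Real.exp (-(4 * π)) * γ / ((L : ℝ) + 1) ^ 2) := by
    refine (Finset.sum_le_sum hA).trans ?_
    rw [← Finset.mul_sum]
    have hq0 : 0 ≤ 2 * Real.exp (-a) := by positivity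
    have hq : 2 * Real.exp (-a) ≤ 1 / 2 := by
      -- `e^{a} ≥ e^{10} ≥ 4`
      rw [Real.exp_neg]
      have : (4 : ℝ) ≤ Real.exp a := by
        have := Real.add_one_le_exp a; linarith
      rw [mul_inv_le_iff₀ (Real.exp_pos a)]
      linarith
    have hgeo := sum_pow_le_of_two_le hq0 hq (Finset.Ico 2 (m₀ + 1)) (fun m hm => (Finset.mem_Ico.1 hm).1)
    -- `36π · 2 (2e^{-a})² = 288 π e^{-2a} ≤ (3/2) e^{-4π}`  iff  `192 π ≤ e^{2a - 4π}`, and `2a - 4π ≥ 8`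
    have hkey : 36 * π * (2 * (2 * Real.exp (-a)) ^ 2) ≤ 3 / 2 * Real.exp (-(4 * π)) := by
      have h2a : 8 ≤ 2 * a - 4 * π := by rw [ha]; linarith
      have hE : (2800 : ℝ) ≤ Real.exp (2 * a - 4 * π) := exp_eight_ge.trans (Real.exp_le_exp.2 h2a)
      have e1 : (2 * Real.exp (-a)) ^ 2 = 4 * (Real.exp (-(4 * π)) / Real.exp (2 * a - 4 * π)) := by
        rw [mul_pow, ← Real.exp_sub, ← Real.exp_nat_mul]
        congr 1
        · norm_num
        · congr 1; push_cast; ring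
      rw [e1]
      have hpos : 0 < Real.exp (2 * a - 4 * π) := Real.exp_pos _
      have hpos' : 0 < Real.exp (-(4 * π)) := Real.exp_pos _
      rw [show 36 * π * (2 * (4 * (Real.exp (-(4 * π)) / Real.exp (2 * a - 4 * π)))) =
        (288 * π / Real.exp (2 * a - 4 * π)) * Real.exp (-(4 * π)) by ring]
      refine mul_le_mul_of_nonneg_right ?_ hpos'.le
      rw [div_le_iff₀ hpos]
      linarith
    calc 36 * π * γ / ((L : ℝ) + 1) ^ 2 * ∑ m ∈ Finset.Ico 2 (m₀ + 1), (2 * Real.exp (-a)) ^ m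
        ≤ 36 * π * γ / ((L : ℝ) + 1) ^ 2 * (2 * (2 * Real.exp (-a)) ^ 2) := by gcongr
      _ = γ / ((L : ℝ) + 1) ^ 2 * (36 * π * (2 * (2 * Real.exp (-a)) ^ 2)) := by ring
      _ ≤ γ / ((L : ℝ) + 1) ^ 2 * (3 / 2 * Real.exp (-(4 * π))) := by gcongr
      _ = 3 / 2 * (Real.exp (-(4 * π)) * γ / ((L : ℝ) + 1) ^ 2) := by ring
  -- **Case B**: the modes `m₀ < m ≤ L`
  set b : ℝ := 19 / 20 * (7 / 2) * π / 11 * ((L : ℝ) - 9) with hb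
  have hB : ∀ m ∈ Finset.Ico (m₀ + 1) (L + 1), |T m| ≤ 36 * π * γ / ((L : ℝ) + 1) * Real.exp (-b) := by
    intro m hm
    rw [Finset.mem_Ico] at hm
    have hexp : Real.exp b ≤ dstR L m ^ (M + 1) := by
      calc Real.exp b ≤ Real.exp (19 / 20 * dstAngle L m₀ * ((M : ℝ) + 1)) := Real.exp_le_exp.2 hθm₀'
        _ ≤ dstR L m₀ ^ (M + 1) := hpow m₀ hθm₀
        _ ≤ dstR L m ^ (M + 1) := pow_le_pow_left₀ dstR_pos.le (dstR_mono (by omega) (by omega)) _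
    have hb20 : 20 ≤ b := by
      rw [hb]
      have h31 : (31 : ℝ) ≤ L - 9 := by linarith
      have : 19 / 20 * (7 / 2) * π / 11 * 31 ≤ 19 / 20 * (7 / 2) * π / 11 * ((L : ℝ) - 9) :=
        mul_le_mul_of_nonneg_left h31 (by positivity)
      linarith
    have hbig : 2 ≤ dstR L m ^ (M + 1) := by
      refine le_trans ?_ hexp
      have := Real.add_one_le_exp b; linarith
    refine (abs_term_le hγ h1 h2 X₁ (by omega) (by omega) hbig).trans ?_
    have hr : 2 / dstR L m ^ (M + 1) ≤ 2 * Real.exp (-b) := by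
      rw [Real.exp_neg, ← div_eq_mul_inv]
      exact div_le_div_of_nonneg_left (by norm_num) (Real.exp_pos _) hexp
    have hθ : 3 * dstAngle L m ≤ 3 * π := by
      have := dstAngle_le_pi (L := L) (m := m) (by omega); linarith
    calc 6 * γ / ((L : ℝ) + 1) * (3 * dstAngle L m) * (2 / dstR L m ^ (M + 1))
        ≤ 6 * γ / ((L : ℝ) + 1) * (3 * π) * (2 * Real.exp (-b)) := by
          gcongr
      _ = 36 * π * γ / ((L : ℝ) + 1) * Real.exp (-b) := by ring
  have hsumB : ∑ m ∈ Finset.Ico (m₀ + 1) (L + 1), |T m| ≤ 3 / 2 * (Real.exp (-(4 * π)) * γ / ((L : ℝ) + 1) ^ 2) := by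
    refine (Finset.sum_le_sum hB).trans ?_
    rw [Finset.sum_const, Nat.card_Ico, nsmul_eq_mul]
    have hcard : ((L + 1 - (m₀ + 1) : ℕ) : ℝ) ≤ L + 1 := by
      have : L + 1 - (m₀ + 1) ≤ L + 1 := Nat.sub_le _ _
      exact_mod_cast this
    -- `(L+1) · 36πγ/(L+1) · e^{-b} = 36 π γ e^{-b} ≤ (3/2) e^{-4π} γ/(L+1)²`  iff  `24 π (L+1)² ≤ e^{b - 4π}`
    have hkey : 24 * π * ((L : ℝ) + 1) ^ 2 ≤ Real.exp (b - 4 * π) := by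
      have hx : (L : ℝ) + 1 ≤ Real.exp (((L : ℝ) + 1) / 8) := le_exp_div_eight (by linarith)
      have hx2 : ((L : ℝ) + 1) ^ 2 ≤ Real.exp (((L : ℝ) + 1) / 4) := by
        calc ((L : ℝ) + 1) ^ 2 ≤ Real.exp (((L : ℝ) + 1) / 8) ^ 2 := pow_le_pow_left₀ hL1.le hx 2
          _ = Real.exp (((L : ℝ) + 1) / 4) := by rw [← Real.exp_nat_mul]; congr 1; ring
      have hexp5 : 5 ≤ b - 4 * π - ((L : ℝ) + 1) / 4 := by
        rw [hb]
        have hL9 : (0 : ℝ) ≤ L - 9 := by linarith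
        have hcoef : 19 / 20 * (7 / 2) * (157 / 50) / 11 ≤ 19 / 20 * (7 / 2) * π / 11 := by linarith
        have hlow : 19 / 20 * (7 / 2) * (157 / 50) / 11 * ((L : ℝ) - 9) ≤ 19 / 20 * (7 / 2) * π / 11 * ((L : ℝ) - 9) :=
          mul_le_mul_of_nonneg_right hcoef hL9
        linarith
      have h143 : (24 * π : ℝ) ≤ Real.exp (b - 4 * π - ((L : ℝ) + 1) / 4) := by
        have := exp_five_ge.trans (Real.exp_le_exp.2 hexp5)
        linarith
      calc 24 * π * ((L : ℝ) + 1) ^ 2 ≤ Real.exp (b - 4 * π - ((L : ℝ) + 1) / 4) * Real.exp (((L : ℝ) + 1) / 4) := by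
            gcongr
        _ = Real.exp (b - 4 * π) := by rw [← Real.exp_add]; congr 1; ring
    have hfin : 36 * π * γ * Real.exp (-b) * ((L : ℝ) + 1) ^ 2 ≤ 3 / 2 * Real.exp (-(4 * π)) * γ := by
      have h0 : 0 ≤ 3 / 2 * γ * Real.exp (-b) := by positivity
      calc 36 * π * γ * Real.exp (-b) * ((L : ℝ) + 1) ^ 2 = 3 / 2 * γ * Real.exp (-b) * (24 * π * ((L : ℝ) + 1) ^ 2) := by ring
        _ ≤ 3 / 2 * γ * Real.exp (-b) * Real.exp (b - 4 * π) := mul_le_mul_of_nonneg_left hkey h0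
        _ = 3 / 2 * Real.exp (-(4 * π)) * γ := by
            rw [mul_assoc (3 / 2 * γ), ← Real.exp_add, show -b + (b - 4 * π) = -(4 * π) by ring]; ring
    calc ((L + 1 - (m₀ + 1) : ℕ) : ℝ) * (36 * π * γ / ((L : ℝ) + 1) * Real.exp (-b))
        ≤ ((L : ℝ) + 1) * (36 * π * γ / ((L : ℝ) + 1) * Real.exp (-b)) := by gcongr
      _ = 36 * π * γ * Real.exp (-b) := by field_simp
      _ ≤ 3 / 2 * (Real.exp (-(4 * π)) * γ / ((L : ℝ) + 1) ^ 2) := by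
          rw [show 3 / 2 * (Real.exp (-(4 * π)) * γ / ((L : ℝ) + 1) ^ 2) = (3 / 2 * Real.exp (-(4 * π)) * γ) / ((L : ℝ) + 1) ^ 2 by ring,
            le_div_iff₀ (pow_pos hL1 2)]
          exact hfin
  -- assemble
  have hmain := first_term_lower_bound (M := M) (by omega) hM' hγ h1 h2 hX₀ hX₀' hX₁ hX₁'
  have hT1 : T 1 = sineCoeff L (windowData γ X₀) 1 * dstSin L 1 X₁ * (dstProfile L 1 1 / dstProfile L 1 (M + 1)) := rfl
  rw [← hT1] at hmain
  have hA' : -(∑ m ∈ Finset.Ico 2 (m₀ + 1), |T m|) ≤ ∑ m ∈ Finset.Ico 2 (m₀ + 1), T m := by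
    rw [← Finset.sum_neg_distrib]; exact Finset.sum_le_sum fun m _ => neg_abs_le _
  have hB' : -(∑ m ∈ Finset.Ico (m₀ + 1) (L + 1), |T m|) ≤ ∑ m ∈ Finset.Ico (m₀ + 1) (L + 1), T m := by
    rw [← Finset.sum_neg_distrib]; exact Finset.sum_le_sum fun m _ => neg_abs_le _
  have e : 3 * Real.exp (-(4 * π)) * γ / ((L : ℝ) + 1) ^ 2 =
      6 * Real.exp (-(4 * π)) * γ / ((L : ℝ) + 1) ^ 2 - 3 / 2 * (Real.exp (-(4 * π)) * γ / ((L : ℝ) + 1) ^ 2) -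
        3 / 2 * (Real.exp (-(4 * π)) * γ / ((L : ℝ) + 1) ^ 2) := by ring
  rw [e]
  linarith

end Literature.Probability.LatticeModels
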